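import Summits.AtomisticToContinuum.Crystallization.Theorems.FreeSplittingCertificatesStrictSplittingRuleP1HatFirstMoment
import Summits.AtomisticToContinuum.Crystallization.Theorems.FreeSplittingCertificatesStrictSplittingRuleP1CellVarianceW

/-!
# `StrictSplittingRule` (stmt-AtomisticToContinuum-12560): a JENSEN bound on the SECOND moment of a hat function of the quarter triangulation — `∫φ_q|y − y_q|² ≤ V_site·((4/9)a² + h²/3)` (P1 interpolant object, part 25b)

Route `FreeSplittingCertificates`, crux r3 `StrictSplittingRule` (H12⋆ = `stub_coreJointCoercive`), unit b2b-freesplit-B gen 27.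
VALUE = the second-order input of the per-site domination TAIL lemma (HOME FAR-LEMMA-SPEC §20 (c)): beyond a handover radius the hat average of
`|x|⁻⁸` over the star of `q` is `V r⁻⁸[1 − 8⟨ŷ,m₁⟩/r + E₂]` with `m₁` exact (part 25) and `|E₂| ≤ 36(r/(r−√2a))¹⁰·(∫φ_q|y−y_q|²/V)/r²`; this file bounds the trace of
the hat's second moment WITHOUT the (not yet formalised) third-order simplex moments: on each cell Jensen (`|Σλ_{m'}e_{m'}|² ≤ Σλ_{m'}|e_{m'}|²`, part `…P1Variance`) and the
exact `∫_Tλ_mλ_{m'}` (parts 23–24) give `∫_T λ_m|y − y_m|² ≤ (|T|/20)Σ_{m'}|y_{m'} − y_m|²` (`setIntegral_p1Lam_mul_normSq_le`), and over the star (edge multiset of part 25: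
32 in-plane edges `a²`, 32 slanted nearest-neighbour edges `a²/3 + h²`, 8 octahedron diagonals `4a²/3 + h²`)
**`Σ_{incidences}∫_Tλ_q|y − y_q|² ≤ (√3a²h/240)·((160/3)a² + 40h²)`** (`p1Hat_secondMoment_le`), i.e. `tr Σ₂ ≤ (4/9)a² + h²/3` (`= (2/3)a²` at the ideal ratio; the
true value is `≈ a²/3`).  NOT a proof of H12⋆, NOT summit progress.  [folklore: P1 finite elements]
-/

noncomputable section

open Set Function Metric MeasureTheory Filter Topology
open scoped BigOperators NNReal ENNReal

namespace Summit.AtomisticToContinuum.Crystallization.Theorems.StrictSplittingRuleBirth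

open Summit.AtomisticToContinuum.Crystallization.Theorems.PalmUnimodularRigidity.LayeredLawsSelectHcp
  (hcpSite hcpSite_apply_zero hcpSite_apply_one hcpSite_apply_two)
open Literature.MathematicalPhysics.StatisticalMechanics (haggLabel alternatingHagg haggLabel_alternating)

/-- **Jensen second moment of a hat function over a cell**: `∫_T λ_m(y)|y − y_m|² dy ≤ (√3a²h/240)·Σ_{m'}|y_{m'} − y_m|² = (|T|/20)Σ_{m'≠m}|y_{m'} − y_m|²`.
NOT a proof of H12⋆, NOT summit progress. -/
theorem setIntegral_p1Lam_mul_normSq_le {a h : ℝ} (ha : 0 < a) (hh : 0 < h) (i : (ℤ × ℤ × ℤ) × Fin 6) (m : Fin 4) :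
    ∫ y in p1RealCell a h i, p1Lam a h i m y * ∑ k : Fin 3, (y k - hcpSite a h (i.1 + p1VertOff (p1Par i.1) i.2 m) k) ^ 2 ≤
      √3 * a ^ 2 * h / 240 * ∑ m' : Fin 4, ∑ k : Fin 3,
        (hcpSite a h (i.1 + p1VertOff (p1Par i.1) i.2 m') k - hcpSite a h (i.1 + p1VertOff (p1Par i.1) i.2 m) k) ^ 2 := by
  set ym : Fin 4 → Fin 3 → ℝ := fun m' k => hcpSite a h (i.1 + p1VertOff (p1Par i.1) i.2 m') k with hym
  set e : Fin 4 → Fin 3 → ℝ := fun m' k => ym m' k - ym m k with he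
  have hK := isCompact_p1RealCell ha.ne' hh.ne' i
  have hmeas : MeasurableSet (p1RealCell a h i) := (isClosed_p1RealCell a h i).measurableSet
  have hcl : ∀ m', Continuous (p1Lam a h i m') := continuous_p1Lam a h i
  -- pointwise on the cell: |y − y_m|² = q(Σλ_{m'}e_{m'}) ≤ Σλ_{m'}q(e_{m'})
  have hpt : ∀ y ∈ p1RealCell a h i, p1Lam a h i m y * ∑ k : Fin 3, (y k - ym m k) ^ 2 ≤
      p1Lam a h i m y * ∑ m' : Fin 4, p1Lam a h i m' y * p1Quad3 (fun k l => if k = l then (1 : ℝ) else 0) (e m') := by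
    intro y hy
    have hrep : ∀ k, y k - ym m k = ∑ m' : Fin 4, p1Lam a h i m' y * e m' k := by
      intro k
      have h1 := sum_p1Lam_eq_one a h i y
      have h2 := sum_p1Lam_mul_hcpSite ha.ne' hh.ne' hy k
      simp only [he, hym, mul_sub, Finset.sum_sub_distrib, ← Finset.sum_mul, h1, h2, one_mul]
    have hj := p1_jensen_quad (fun k l => if k = l then (1 : ℝ) else 0) p1Quad3_one_nonneg (fun m' => p1Lam a h i m' y)
      (fun m' => p1Lam_nonneg_of_mem hy m') (sum_p1Lam_eq_one a h i y) e
    rw [p1Quad3_one] at hj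
    have hq : ∑ k : Fin 3, (y k - ym m k) ^ 2 = (∑ m' : Fin 4, p1Lam a h i m' y * e m' 0) ^ 2 +
        (∑ m' : Fin 4, p1Lam a h i m' y * e m' 1) ^ 2 + (∑ m' : Fin 4, p1Lam a h i m' y * e m' 2) ^ 2 := by
      rw [Fin.sum_univ_three, hrep 0, hrep 1, hrep 2]
    rw [hq]
    exact mul_le_mul_of_nonneg_left hj (p1Lam_nonneg_of_mem hy m)
  have iL : IntegrableOn (fun y => p1Lam a h i m y * ∑ k : Fin 3, (y k - ym m k) ^ 2) (p1RealCell a h i) volume :=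
    ((hcl m).mul (by fun_prop)).continuousOn.integrableOn_compact hK
  have iR : IntegrableOn (fun y => p1Lam a h i m y * ∑ m' : Fin 4, p1Lam a h i m' y * p1Quad3 (fun k l => if k = l then (1 : ℝ) else 0) (e m'))
      (p1RealCell a h i) volume :=
    ((hcl m).mul (continuous_finsetSum _ fun m' _ => (hcl m').mul continuous_const)).continuousOn.integrableOn_compact hK
  have step1 := setIntegral_mono_on iL iR hmeas hpt
  refine step1.trans (le_of_eq ?_)
  -- integrate the right side exactly with the second moments
  have hsplit : (fun y => p1Lam a h i m y * ∑ m' : Fin 4, p1Lam a h i m' y * p1Quad3 (fun k l => if k = l then (1 : ℝ) else 0) (e m')) =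
      fun y => ∑ m' : Fin 4, p1Quad3 (fun k l => if k = l then (1 : ℝ) else 0) (e m') * (p1Lam a h i m y * p1Lam a h i m' y) := by
    funext y; rw [Finset.mul_sum]; refine Finset.sum_congr rfl fun m' _ => ?_; ring
  rw [hsplit, integral_finsetSum _ (fun m' _ => (integrableOn_p1Lam_mul ha hh i m m').const_mul _)]
  simp only [integral_const_mul, setIntegral_p1Lam_mul ha hh]
  rw [Finset.mul_sum]
  refine Finset.sum_congr rfl fun m' _ => ?_
  rw [p1Quad3_one, Fin.sum_univ_three]
  split_ifs with hmm
  · subst hmm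
    simp [he]
  · ring

/-- The squared edge lengths summed over the star's edge multiset (part 25's `p1Star_sum_offsets`): `(160/3)a² + 40h²` for either parity
(32 in-plane edges `a²`, 32 slanted nearest-neighbour edges `a²/3 + h²`, 8 octahedron diagonals `4a²/3 + h²`). -/
theorem p1StarSum_normSq (a h : ℝ) (q : ℤ × ℤ × ℤ) :
    (let G : ℤ × ℤ × ℤ → ℝ := fun d => ∑ k : Fin 3, (hcpSite a h (q + d) k - hcpSite a h q k) ^ 2
     if Even q.1 then
        (4 * G (-1, -1, 0) + 6 * G (-1, 0, -1) + 6 * G (-1, 0, 0) + 4 * G (-1, 1, -1) + 6 * G (0, -1, 0) + 6 * G (0, -1, 1) +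
          4 * G (0, 0, -1) + 24 * G (0, 0, 0) + 4 * G (0, 0, 1) + 6 * G (0, 1, -1) + 6 * G (0, 1, 0) + 4 * G (1, -1, 0) +
          6 * G (1, 0, -1) + 6 * G (1, 0, 0) + 4 * G (1, 1, -1))
      else
        (4 * G (-1, -1, 1) + 6 * G (-1, 0, 0) + 6 * G (-1, 0, 1) + 4 * G (-1, 1, 0) + 6 * G (0, -1, 0) + 6 * G (0, -1, 1) +
          4 * G (0, 0, -1) + 24 * G (0, 0, 0) + 4 * G (0, 0, 1) + 6 * G (0, 1, -1) + 6 * G (0, 1, 0) + 4 * G (1, -1, 1) +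
          6 * G (1, 0, 0) + 6 * G (1, 0, 1) + 4 * G (1, 1, 0))) = 160 / 3 * a ^ 2 + 40 * h ^ 2 := by
  obtain ⟨qk, qi, qj⟩ := q
  have h3 : √3 ^ 2 = 3 := Real.sq_sqrt (by norm_num)
  rcases Int.even_or_odd qk with hk | hk
  · have hk1 : ¬Even (qk + 1) := by rw [Int.even_add_one]; exact not_not.2 hk
    have hk2 : ¬Even (qk + -1) := by rw [← sub_eq_add_neg, Int.even_sub_one]; exact not_not.2 hk
    simp [hk, hk1, hk2, Fin.sum_univ_three, hcpSite_apply_zero, hcpSite_apply_one, hcpSite_apply_two, haggLabel_alternating]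
    nlinarith [h3]
  · have hk0 : ¬Even qk := Int.not_even_iff_odd.2 hk
    have hk1 : Even (qk + 1) := by rw [Int.even_add_one]; exact hk0
    have hk2 : Even (qk + -1) := by rw [← sub_eq_add_neg, Int.even_sub_one]; exact hk0
    simp [hk0, hk1, hk2, Fin.sum_univ_three, hcpSite_apply_zero, hcpSite_apply_one, hcpSite_apply_two, haggLabel_alternating]
    nlinarith [h3]

/-- **JENSEN BOUND ON THE HAT SECOND MOMENT (star form)**: for every site `q`,
`Σ_{incidences (o,π,m) of the star of q} ∫_{cell (q−o,π)} λ_m(y)|y − y_q|² dy ≤ (√3a²h/240)·((160/3)a² + 40h²)`, i.e. `∫φ_q|y − y_q|² ≤ V_site·((4/9)a² + h²/3)`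
(`V_site = √3a²h/2`).  NOT a proof of H12⋆, NOT summit progress. -/
theorem p1Hat_secondMoment_le {a h : ℝ} (ha : 0 < a) (hh : 0 < h) (q : ℤ × ℤ × ℤ) :
    (∑ o ∈ p1Corners, ∑ π : Fin 6, ∑ m : Fin 4,
        if p1VertOff (p1Par (q - o)) π m = o then
          ∫ y in p1RealCell a h (q - o, π), p1Lam a h (q - o, π) m y * ∑ k : Fin 3, (y k - hcpSite a h q k) ^ 2 else 0) ≤
      √3 * a ^ 2 * h / 240 * (160 / 3 * a ^ 2 + 40 * h ^ 2) := by
  -- bound each incidence by the cell lemma, then evaluate the edge multiset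
  have hle : (∑ o ∈ p1Corners, ∑ π : Fin 6, ∑ m : Fin 4,
        if p1VertOff (p1Par (q - o)) π m = o then
          ∫ y in p1RealCell a h (q - o, π), p1Lam a h (q - o, π) m y * ∑ k : Fin 3, (y k - hcpSite a h q k) ^ 2 else 0) ≤
      ∑ o ∈ p1Corners, ∑ π : Fin 6, ∑ m : Fin 4,
        if p1VertOff (p1Par (q - o)) π m = o then
          √3 * a ^ 2 * h / 240 * ∑ m' : Fin 4, ∑ k : Fin 3,
            (hcpSite a h ((q - o) + p1VertOff (p1Par (q - o)) π m') k - hcpSite a h q k) ^ 2 else 0 := by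
    refine Finset.sum_le_sum fun o _ => Finset.sum_le_sum fun π _ => Finset.sum_le_sum fun m _ => ?_
    split_ifs with ho
    · have hq : (q - o) + p1VertOff (p1Par (q - o)) π m = q := by rw [ho]; abel
      have := setIntegral_p1Lam_mul_normSq_le ha hh (q - o, π) m
      simp only [hq] at this
      exact this
    · exact le_rfl
  refine hle.trans (le_of_eq ?_)
  have hG := p1Star_sum_offsets q (fun d => (∑ k : Fin 3, (hcpSite a h (q + d) k - hcpSite a h q k) ^ 2 : ℝ))
  have hW := p1StarSum_normSq a h q
  simp only [] at hW
  rw [← hW, ← hG]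
  conv_rhs => rw [Finset.mul_sum]
  refine Finset.sum_congr rfl fun o _ => ?_
  conv_rhs => rw [Finset.mul_sum]
  refine Finset.sum_congr rfl fun π _ => ?_
  conv_rhs => rw [Finset.mul_sum]
  refine Finset.sum_congr rfl fun m _ => ?_
  split_ifs with ho
  · congr 1
    refine Finset.sum_congr rfl fun m' _ => ?_
    rw [show q - o + p1VertOff (p1Par (q - o)) π m' = q + (p1VertOff (p1Par (q - o)) π m' - o) by abel]
  · simp

end Summit.AtomisticToContinuum.Crystallization.Theorems.StrictSplittingRuleBirth

end
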